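import Mathlib.RingTheory.MvPolynomial.Homogeneous
import Mathlib.RingTheory.MvPolynomial.Symmetric.Defs
import Mathlib.RingTheory.Localization.FractionRing
import Mathlib.Algebra.MvPolynomial.Funext
import Literature.LinearAlgebra.Matrix.RankMinors
import Literature.Computability.AlgebraicComplexity.SetMultilinear
import Literature.Computability.AlgebraicComplexity.RankMethodBarriersWaring
import Literature.Barriers.ValiantsHypothesis.RankMethods
import HarnessLib

/-!
# EGOW 2018 §2–§3 and §5 — rank of matrix spaces, symbolic / homogeneous / set-multilinear rank,
coefficient spaces, and the depth-3 instantiation of the rank method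
(cell val-lit, typer t22, DAG row EGOW2018-A; source `paper:arxiv-1710.09502`;
bib `EfremenkoGargOliveiraWigderson2018`)

K. Efremenko, A. Garg, R. Oliveira, A. Wigderson, *Barriers for rank methods in arithmetic
complexity*, ITCS 2018 = arXiv:1710.09502 (numbering of the arXiv version; the locators
`pNNNN.txt:Lnn` below are the chunks of `lit read arxiv:1710.09502`). Topic
`Literature/Computability/AlgebraicComplexity`, companion of `RankMethodBarriers.lean` (the printed
theorems) and of the barrier entry `Literature/Barriers/ValiantsHypothesis/RankMethods.lean`.
HONEST FRAMING: known mathematics, typed and proved; `VP ≠ VNP` is NOT proved and nothing here is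
progress on it. Numbered statements carry the cell's names `EGOW2018_<kind><digits>` (precedent
`EGOW2018_thm42`); definitions carry descriptive names.

## What the tree already has (CITED, not restated)

* §1.1–1.2, Def 4.1, Thm 4.2, Cor 4.3, Thm 4.4, Cor 4.5, Thm 1.1, Thm 1.2:
  `Literature/Computability/AlgebraicComplexity/RankMethodBarriers.lean` (`sComplexity`, `rankMeasure`,
  `RankMethodCeiling`, `rankOneTensors`, `tensorRankD`, `affineForm`, `linearForm`, `affinePowers`,
  `polyWaringRank`, named facts `EGOW2018_thm44` / `EGOW2018_thm11` / `EGOW2018_thm42` /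
  `EGOW2018_thm12`), ALL FOUR PROVED (`EGOW2018_thm44_holds`, `EGOW2018_thm11_holds` in
  `RankMethodBarriersProofs.lean`; `EGOW2018_thm42_holds`, `EGOW2018_thm12_holds` in
  `RankMethodBarriersWaring.lean`); barrier entry `Literature.Barriers.ValiantsHypothesis.RankMethods`
  (`RankMethods.lean`, `RankMethods_holds` in `RankMethodsProofs.lean`). CHECK against the print
  (p0005, p0006, p0012–p0014) done this session: FAITHFUL (constants `2^d · n^{⌊d/2⌋}`,
  `(d+1) · C(n+⌊d/2⌋, n)`; affine forms in Thm 4.2, linear forms in Def 4.1; standing hypothesis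
  algebraically closed of characteristic zero, §2.1).
* Def 2.1 `H_t` = Mathlib `MvPolynomial.homogeneousComponent t`; Def 2.2 `H^{SM}_S` = the tree's
  `Literature.Computability.AlgebraicComplexity.smlProj blk S` (set-multilinear projection,
  `SetMultilinear.lean`; block map `blk = Prod.fst : Fin d × Fin n → Fin d` for the paper's partition
  `x = (x_1, …, x_d)`), `IsSetMultilinear`; Lemma 2.4 (Schwartz–Zippel) = Mathlib
  `MvPolynomial.schwartz_zippel_sup_sum` (only `MvPolynomial.funext` over infinite fields is used here).
* Lemma 2.7 / Prop 2.6 in the MINOR form the tree's proofs use: `exists_maxMinor_factorization`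
  (`SymbolicMatrixMinors.lean`); Lemma 3.2, Lemma 3.3, Lemma 3.5 in WEIGHTED form:
  `exists_translate_decomposition`, `exists_weighted_decomposition`
  (`SymbolicMatrixDecomposition.lean`); Prop 2.8 / Cor 2.11 / 2.13 in the usage form
  `rank_sum_smul_eval_mul_le_left/right`, Def 2.9 as `map_eval_eq_sum_coeff`
  (`CoefficientSpaceRank.lean`); the rank–minor dictionary `Literature/LinearAlgebra/Matrix/RankMinors.lean`.

## What this file adds (AS PRINTED, all PROVED; no named fact, no conjecture)

* Def 2.1 `H_{≤ t}`: `homogeneousComponentLE` (p0008:L43–49).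
* Def 2.5 rank of a set of matrices `matrixSetRank` (p0008:L105); the symbolic rank `rk_{F(x)}`
  `symbolicRank` (p0008:L102–103) over `FractionRing (MvPolynomial σ F)`; **Prop 2.6**
  `EGOW2018_prop26` (p0009:L1–5) and **Lemma 2.7** `EGOW2018_lem27` (p0009:L10–15), both PROVED for
  infinite `F` (the paper: characteristic zero, §2.1); `rank_map_eval_le_symbolicRank` (any field).
* Def 2.9 coefficient spaces `coeffSpaceVec` / `coeffSpace` (p0009:L47–58); **Prop 2.8**
  `EGOW2018_prop28` (p0009:L21–26, the printed EQUALITY `rk(span(U ⊗ V)) = min(dim U, dim V)`),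
  **Prop 2.10** `EGOW2018_prop210` (p0009:L63–67), **Cor 2.11** `EGOW2018_cor211` (p0009:L72–77),
  **Prop 2.12** `EGOW2018_prop212` (p0009:L85–91; `finrank_coeffSpaceVec_le_pow` is the version for a
  sub-family `S` of the blocks that Cor 2.13 silently uses), **Cor 2.13** `EGOW2018_cor213`
  (p0009:L96–106).
* Def 3.1 homogeneous rank `homogRank` = `hrk` (p0010:L26–33), **Lemma 3.3** `EGOW2018_lem33`
  (p0010:L105–109) with its pointwise-rank form `homogRank_le_of_forall_rank_le`; Def 3.4
  set-multilinear rank `smlRank` = `smrk` (p0011:L19–43), **Lemma 3.5** `EGOW2018_lem35`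
  (p0011:L48–52) with `smlRank_le_of_forall_rank_le` — from the tree's weighted decomposition theorem.
* §5 (p0015–p0016), the proposed rank-method instantiation for non-homogeneous depth-3 formulas:
  the normal form `f = ∑_{i ≤ s} α_i ∏_{j ≤ D} (1 + ℓ_{ij})` (`HasDepthThreeForm`, p0015:L28–36), the
  simple polynomials `S_D = {Sym_d(ℓ_1, …, ℓ_D)}` (`symLinear`, `depthThreeSimple`, p0015:L38–45), the
  displayed identity `H_d[∏ (1 + ℓ_i)] = Sym_d(ℓ_1, …, ℓ_D)` (`homogeneousComponent_prod_one_add_linearForm`),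
  the parameter map `ψ` (`depthThreePsi`, eq. (5.1) p0015:L49–53, with `map_eval_depthThreePsi`:
  `ψ(ℓ) = Sym_d(ℓ)`) and the soundness of the restated method ("to prove a lower bound of `R` … one
  has to show that the rank of `L(Ŝ_D)` is at least `r · R`", p0015:L89–91):
  `rank_le_of_hasDepthThreeForm`, `lt_of_hasDepthThreeForm_of_lt_rank`.
* **Conjecture 6.1** (p0017:L27–29) is NOT in this file: conjectures are not Literature (D-0014); it
  is filed as the obligation `@[conjecture] def EGOW2018_conj61` in
  `Summits/ValiantsHypothesis/ValiantsHypothesis/Theorems/EGOW2018Conj61.lean`, stated over this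
  file's `symbolicRank` and `homogRank` (LOAD-BEARING decl of the cell's GAP row for this source).

## Errata / not typed (results of the CHECK, reported on the cell bus)

* §5 claim "`𝓛 = SSM(y)`" (p0015:L58–78) is argued by a dimension count whose displayed
  symmetrisation map `x_{i_1} ⋯ x_{i_d} ↦ ∑_{σ ∈ S_n} ∏_j x_{σ(i_j)}` (p0015:L76–77) is garbled as
  printed (it permutes VARIABLE indices and lands in `F[x]`, not in `SSM(y)`); the intended map sends
  `x^e` to the `y`-coefficient of `x^e` in `ψ`. We type `ψ` and `S_D` and do not vendor the claim.
* The two printed forms of the [GL17] Waring lower bound differ (p0006: `C(n+⌊d/2⌋−1, ⌊d/2⌋) + ⌊n/2⌋ − 1`;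
  p0012:L34: `C(n+⌊d/2⌋−1, n) + ⌊n/2⌋ − 1`); neither is an EGOW result and neither is typed.
* §6 bullets 1–3 (non-linear `L` "possibly of low degree", more models, flattenings in algebraic
  geometry; p0017:L13–17) are research directions without a printed statement; typing them would
  mint a conjecture of ours (not Literature, D-0014/README) — not typed; Conjecture 6.1 (the only
  precise one) is the Summits-side obligation named above.
* §5 cites [K12, GKKS13] (depth-3 chasm: tree `sigmaPiSigma_edgeSize_le_of_complexity`,
  `DepthThreeChasm.lean`) and [KST16] (near-cubic depth-3 lower bound; not in the tree) — context only.

## References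

* [EfremenkoGargOliveiraWigderson2018] K. Efremenko, A. Garg, R. Oliveira, A. Wigderson,
  *Barriers for rank methods in arithmetic complexity*, ITCS 2018, LIPIcs 94, 1:1–1:19;
  arXiv:1710.09502, §2.1–2.3 (pp. 8–9), §3 (pp. 10–11), §5 (pp. 15–16), §6 (p. 17).
-/

noncomputable section

open MvPolynomial Finsupp

namespace Literature.Computability.AlgebraicComplexity

/-! ## Def 2.1: truncation `H_{≤ t}` -/

section Trunc

variable {R : Type*} [CommSemiring R] {σ : Type*}

/-- **EGOW 2018, Definition 2.1** (`H_{≤ t}`): the sum of the homogeneous components of `f` of degree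
`≤ t`, `H_{≤ t}[f] = ∑_{i=0}^{t} H_i[f]` (the components `H_t` themselves are Mathlib's
`homogeneousComponent t`; for matrices of polynomials the paper applies both entrywise, i.e.
`Matrix.map`). [cite: EfremenkoGargOliveiraWigderson2018, Def 2.1, p. 8] locator: paper:arxiv-1710.09502 p0008.txt:L43 -/
def homogeneousComponentLE (t : ℕ) : MvPolynomial σ R →ₗ[R] MvPolynomial σ R :=
  ∑ i ∈ Finset.range (t + 1), homogeneousComponent i

/-- Unfolding lemma for `H_{≤ t}`. [cite: EfremenkoGargOliveiraWigderson2018, Def 2.1, p. 8] locator: paper:arxiv-1710.09502 p0008.txt:L47 -/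
theorem homogeneousComponentLE_apply (t : ℕ) (f : MvPolynomial σ R) :
    homogeneousComponentLE t f = ∑ i ∈ Finset.range (t + 1), homogeneousComponent i f := by
  simp [homogeneousComponentLE, LinearMap.sum_apply]

/-- `H_{≤ t}` keeps exactly the monomials of degree `≤ t`. [cite: EfremenkoGargOliveiraWigderson2018, Def 2.1, p. 8] locator: paper:arxiv-1710.09502 p0008.txt:L47 -/
theorem coeff_homogeneousComponentLE (t : ℕ) (f : MvPolynomial σ R) (e : σ →₀ ℕ) :
    coeff e (homogeneousComponentLE t f) = if e.degree ≤ t then coeff e f else 0 := by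
  classical
  rw [homogeneousComponentLE_apply, coeff_sum]
  simp_rw [coeff_homogeneousComponent]
  rw [Finset.sum_ite_eq]
  simp only [Finset.mem_range, Nat.lt_succ_iff]

/-- `H_{≤ t}[f] = f` when `deg f ≤ t` (used in the proof of Lemma 3.2: "`M(x + a) = H_{≤ d}[M(x + a)]`",
p. 10). [cite: EfremenkoGargOliveiraWigderson2018, Def 2.1 and Lemma 3.2, p. 10] locator: paper:arxiv-1710.09502 p0010.txt:L81 -/
theorem homogeneousComponentLE_eq_self {t : ℕ} {f : MvPolynomial σ R} (hf : f.totalDegree ≤ t) :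
    homogeneousComponentLE t f = f := by
  classical
  ext e
  rw [coeff_homogeneousComponentLE]
  split_ifs with h
  · rfl
  · symm
    by_contra hne
    exact h (le_trans (le_totalDegree (MvPolynomial.mem_support_iff.mpr hne)) hf)

end Trunc

/-! ## §2.2: rank of a matrix space, symbolic rank (Def 2.5, Prop 2.6, Lemma 2.7) -/

section MatrixSpaces

variable {F : Type*} [Field F] {m n : Type*} [Fintype n]

/-- **EGOW 2018, Definition 2.5 (rank of a set of matrices).** `rk(𝓜) = max_{M ∈ 𝓜} rk(M)` for a
set `𝓜 ⊆ Mat(F)`; as a supremum in `ℕ` (the ranks are bounded by the number of columns, so the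
supremum is a maximum for non-empty `𝓜`; `rk(∅) = 0`). [cite: EfremenkoGargOliveiraWigderson2018, Def 2.5, p. 8] locator: paper:arxiv-1710.09502 p0008.txt:L105 -/
def matrixSetRank (𝓜 : Set (Matrix m n F)) : ℕ :=
  sSup ((fun M : Matrix m n F => M.rank) '' 𝓜)

/-- Every member's rank is at most the rank of the set. [cite: EfremenkoGargOliveiraWigderson2018, Def 2.5, p. 8] locator: paper:arxiv-1710.09502 p0008.txt:L109 -/
theorem rank_le_matrixSetRank {𝓜 : Set (Matrix m n F)} {M : Matrix m n F} (hM : M ∈ 𝓜) :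
    M.rank ≤ matrixSetRank 𝓜 :=
  le_csSup ⟨Fintype.card n, by rintro _ ⟨N, -, rfl⟩; exact Matrix.rank_le_card_width N⟩ ⟨M, hM, rfl⟩

/-- A uniform bound on the members bounds the rank of the set. [cite: EfremenkoGargOliveiraWigderson2018, Def 2.5, p. 8] locator: paper:arxiv-1710.09502 p0008.txt:L109 -/
theorem matrixSetRank_le {𝓜 : Set (Matrix m n F)} {r : ℕ} (h : ∀ M ∈ 𝓜, M.rank ≤ r) :
    matrixSetRank 𝓜 ≤ r :=
  csSup_le' (by rintro _ ⟨M, hM, rfl⟩; exact h M hM)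

/-- `rk(𝓜) ≤ r` iff every member has rank `≤ r`. [cite: EfremenkoGargOliveiraWigderson2018, Def 2.5, p. 8] locator: paper:arxiv-1710.09502 p0008.txt:L109 -/
theorem matrixSetRank_le_iff {𝓜 : Set (Matrix m n F)} {r : ℕ} :
    matrixSetRank 𝓜 ≤ r ↔ ∀ M ∈ 𝓜, M.rank ≤ r :=
  ⟨fun h _ hM => (rank_le_matrixSetRank hM).trans h, matrixSetRank_le⟩

/-- The rank of a set is monotone in the set. [cite: EfremenkoGargOliveiraWigderson2018, Def 2.5, p. 8] locator: paper:arxiv-1710.09502 p0008.txt:L109 -/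
theorem matrixSetRank_mono {𝓜 𝓝 : Set (Matrix m n F)} (h : 𝓜 ⊆ 𝓝) :
    matrixSetRank 𝓜 ≤ matrixSetRank 𝓝 :=
  matrixSetRank_le fun _ hM => rank_le_matrixSetRank (h hM)

variable {σ : Type*} {ι κ : Type*} [Fintype κ]

/-- **Symbolic rank** `rk_{F(x)}(M(x))` of a matrix with polynomial entries: its rank over the field
of rational functions `F(x)` (EGOW 2018, §2.2, "we denote `rk_{F(x_1, …, x_k)}(∑ x_i M_i)` the
symbolic rank"). [cite: EfremenkoGargOliveiraWigderson2018, §2.2, p. 8] locator: paper:arxiv-1710.09502 p0008.txt:L102 -/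
def symbolicRank (P : Matrix ι κ (MvPolynomial σ F)) : ℕ :=
  (P.map (algebraMap (MvPolynomial σ F) (FractionRing (MvPolynomial σ F)))).rank

omit [Fintype κ] in
/-- Minors commute with evaluation (the step "`rk_F(M(a)) ≤ r` for all `a`" ↔ vanishing of evaluated minors in Lemma 2.7). [cite: EfremenkoGargOliveiraWigderson2018, Lemma 2.7 (proof), p. 9] locator: paper:arxiv-1710.09502 p0009.txt:L10 -/
theorem det_submatrix_map_eval {s : ℕ} (P : Matrix ι κ (MvPolynomial σ F)) (b : σ → F)
    (r : Fin s → ι) (c : Fin s → κ) :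
    ((P.map (eval b)).submatrix r c).det = eval b (P.submatrix r c).det := by
  rw [RingHom.map_det, RingHom.mapMatrix_apply, Matrix.submatrix_map]

omit [Fintype κ] in
/-- Minors commute with the passage to the fraction field `F(x)` (symbolic rank via minors, Lemma 2.7). [cite: EfremenkoGargOliveiraWigderson2018, Lemma 2.7 (proof), p. 9] locator: paper:arxiv-1710.09502 p0009.txt:L10 -/
theorem det_submatrix_map_algebraMap {s : ℕ} (P : Matrix ι κ (MvPolynomial σ F))
    (r : Fin s → ι) (c : Fin s → κ) :
    ((P.map (algebraMap (MvPolynomial σ F) (FractionRing (MvPolynomial σ F)))).submatrix r c).det =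
      algebraMap _ (FractionRing (MvPolynomial σ F)) (P.submatrix r c).det := by
  rw [RingHom.map_det, RingHom.mapMatrix_apply, Matrix.submatrix_map]

variable [Fintype ι]

/-- **Every evaluation has rank at most the symbolic rank** (any field): a non-zero minor of `M(b)`
is the evaluation of a non-zero polynomial minor of `M(x)`. This is the direction of Prop 2.6 /
Lemma 2.7 that needs no largeness of the field. [cite: EfremenkoGargOliveiraWigderson2018, Prop 2.6, p. 9] locator: paper:arxiv-1710.09502 p0009.txt:L1 -/
theorem rank_map_eval_le_symbolicRank (P : Matrix ι κ (MvPolynomial σ F)) (b : σ → F) :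
    (P.map (eval b)).rank ≤ symbolicRank P := by
  obtain ⟨r, c, h⟩ := (Literature.LinearAlgebra.Matrix.le_rank_iff_exists_det_submatrix_ne_zero
    (P.map (eval b))).1 le_rfl
  refine (Literature.LinearAlgebra.Matrix.le_rank_iff_exists_det_submatrix_ne_zero _).2 ⟨r, c, ?_⟩
  rw [det_submatrix_map_algebraMap]
  intro h0
  apply h
  rw [det_submatrix_map_eval,
    (IsFractionRing.injective (MvPolynomial σ F) (FractionRing (MvPolynomial σ F)))
      (h0.trans (map_zero _).symm), map_zero]

variable [Infinite F]

/-- **The symbolic rank is attained at some point** (infinite `F`): a non-zero polynomial minor of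
size `rk_{F(x)}(M)` does not vanish identically (the use of Lemma 2.4 in the paper).
[cite: EfremenkoGargOliveiraWigderson2018, Prop 2.6 and Lemma 2.7, p. 9] locator: paper:arxiv-1710.09502 p0009.txt:L7 -/
theorem exists_symbolicRank_le_rank_map_eval (P : Matrix ι κ (MvPolynomial σ F)) :
    ∃ b : σ → F, symbolicRank P ≤ (P.map (eval b)).rank := by
  obtain ⟨r, c, h⟩ :=
    (Literature.LinearAlgebra.Matrix.le_rank_iff_exists_det_submatrix_ne_zero _).1
      (le_refl (symbolicRank P))
  rw [det_submatrix_map_algebraMap] at h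
  have hq : (P.submatrix r c).det ≠ 0 := fun h0 => h (by rw [h0, map_zero])
  obtain ⟨b, hb⟩ : ∃ b : σ → F, eval b (P.submatrix r c).det ≠ 0 := by
    by_contra hall
    push Not at hall
    exact hq (MvPolynomial.funext fun b => by rw [hall b, map_zero])
  refine ⟨b, (Literature.LinearAlgebra.Matrix.le_rank_iff_exists_det_submatrix_ne_zero _).2
    ⟨r, c, ?_⟩⟩
  rwa [det_submatrix_map_eval]

/-- **EGOW 2018, Lemma 2.7 (Rank Upper Bound on Polynomial Matrices), as printed.** If
`rk_F(M(a)) ≤ r` for all `a ∈ F^n` then `rk_{F(x)}(M(x)) ≤ r` (infinite `F`; the paper's standing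
assumption is characteristic zero, §2.1 with footnote). [cite: EfremenkoGargOliveiraWigderson2018, Lemma 2.7, p. 9] locator: paper:arxiv-1710.09502 p0009.txt:L10 -/
theorem EGOW2018_lem27 (P : Matrix ι κ (MvPolynomial σ F)) {r : ℕ}
    (h : ∀ a : σ → F, (P.map (eval a)).rank ≤ r) : symbolicRank P ≤ r := by
  obtain ⟨b, hb⟩ := exists_symbolicRank_le_rank_map_eval P
  exact hb.trans (h b)

/-- The generic linear combination `∑ᵢ xᵢ Mᵢ ∈ Mat(F[x₁, …, x_k])` of matrices `M₁, …, M_k`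
(EGOW 2018, §2.2 / Prop 2.6). [cite: EfremenkoGargOliveiraWigderson2018, Prop 2.6, p. 9] locator: paper:arxiv-1710.09502 p0009.txt:L5 -/
def genericCombination {k : ℕ} (M : Fin k → Matrix ι κ F) : Matrix ι κ (MvPolynomial (Fin k) F) :=
  ∑ i, (X i : MvPolynomial (Fin k) F) • (M i).map C

omit [Fintype ι] [Fintype κ] [Infinite F] in
/-- Evaluating the generic combination at `b` gives `∑ᵢ bᵢ Mᵢ`. [cite: EfremenkoGargOliveiraWigderson2018, Prop 2.6, p. 9] locator: paper:arxiv-1710.09502 p0009.txt:L5 -/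
theorem genericCombination_map_eval {k : ℕ} (M : Fin k → Matrix ι κ F) (b : Fin k → F) :
    (genericCombination M).map (eval b) = ∑ i, b i • M i := by
  ext j l
  simp [genericCombination, Matrix.sum_apply, Matrix.smul_apply, Matrix.map_apply, smul_eq_mul]

/-- **EGOW 2018, Proposition 2.6, as printed (for any finite spanning family, in particular a
basis).** For the linear space of matrices `𝓜 = span(M₁, …, M_k)`,
`rk(𝓜) = rk_{F(x₁,…,x_k)}(∑ᵢ xᵢ Mᵢ)` (infinite `F`). [cite: EfremenkoGargOliveiraWigderson2018, Prop 2.6, p. 9] locator: paper:arxiv-1710.09502 p0009.txt:L1 -/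
theorem EGOW2018_prop26 {k : ℕ} (M : Fin k → Matrix ι κ F) :
    matrixSetRank (Submodule.span F (Set.range M) : Set (Matrix ι κ F)) =
      symbolicRank (genericCombination M) := by
  refine le_antisymm (matrixSetRank_le fun N hN => ?_) ?_
  · obtain ⟨c, rfl⟩ := (Submodule.mem_span_range_iff_exists_fun F).1 hN
    rw [← genericCombination_map_eval]
    exact rank_map_eval_le_symbolicRank _ _
  · obtain ⟨b, hb⟩ := exists_symbolicRank_le_rank_map_eval (genericCombination M)
    refine hb.trans ?_
    rw [genericCombination_map_eval]
    exact rank_le_matrixSetRank ((Submodule.mem_span_range_iff_exists_fun F).2 ⟨b, rfl⟩)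

end MatrixSpaces

/-! ## §2.3: coefficient spaces (Def 2.9, Prop 2.8, Prop 2.10, Cor 2.11, Prop 2.12, Cor 2.13) -/

section CoefficientSpaces

variable {F : Type*} [Field F] {σ : Type*} {ι κ : Type*}

/-- **EGOW 2018, Definition 2.9 (coefficient space), vector case.** For `f ∈ F[x]^ι`, written
`f = ∑_e f_e x^e` with `f_e ∈ F^ι`, `𝒞(f) = span{f_e}` — the span of the coefficient vectors. (The
paper's divided-power normalisation `x^a = (1/a!) ∏ x_i^{a_i}` of §2.1 rescales each `f_e` by the unit
`e!` in characteristic zero and does not change the span; we use Mathlib's `coeff`.)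
[cite: EfremenkoGargOliveiraWigderson2018, Def 2.9, p. 9] locator: paper:arxiv-1710.09502 p0009.txt:L47 -/
def coeffSpaceVec (f : ι → MvPolynomial σ F) : Submodule F (ι → F) :=
  Submodule.span F (Set.range fun e : σ →₀ ℕ => fun i => coeff e (f i))

/-- **EGOW 2018, Definition 2.9 (coefficient space), matrix case.** For `M(x) = ∑_e M_e x^e ∈ F[x]^{ι × κ}`,
`𝒞(M(x)) = span{M_e} ⊆ F^{ι × κ}`. [cite: EfremenkoGargOliveiraWigderson2018, Def 2.9, p. 9] locator: paper:arxiv-1710.09502 p0009.txt:L53 -/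
def coeffSpace (P : Matrix ι κ (MvPolynomial σ F)) : Submodule F (Matrix ι κ F) :=
  Submodule.span F (Set.range fun e : σ →₀ ℕ => P.map (coeff e))

/-- The coefficient vectors lie in `𝒞(f)`. [cite: EfremenkoGargOliveiraWigderson2018, Def 2.9, p. 9] locator: paper:arxiv-1710.09502 p0009.txt:L56 -/
theorem coeffVec_mem_coeffSpaceVec (f : ι → MvPolynomial σ F) (e : σ →₀ ℕ) :
    (fun i => coeff e (f i)) ∈ coeffSpaceVec f :=
  Submodule.subset_span ⟨e, rfl⟩

/-- The set `U ⊗ V = {u ⊗ v : u ∈ U, v ∈ V}` of rank-one matrices with column vector in `U` and row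
vector in `V` (EGOW 2018, Prop 2.8, "`𝓜 = span(U ⊗ V)`"). [cite: EfremenkoGargOliveiraWigderson2018, Prop 2.8, p. 9] locator: paper:arxiv-1710.09502 p0009.txt:L23 -/
def outerSet (U : Submodule F (ι → F)) (V : Submodule F (κ → F)) : Set (Matrix ι κ F) :=
  {N | ∃ u ∈ U, ∃ v ∈ V, Matrix.vecMulVec u v = N}

variable [Fintype ι] [Fintype κ]

omit [Fintype ι] [Fintype κ] in
/-- Rows of members of `span(U ⊗ V)` lie in `V` and columns in `U`. [cite: EfremenkoGargOliveiraWigderson2018, Prop 2.8 (proof), p. 9] locator: paper:arxiv-1710.09502 p0009.txt:L28 -/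
theorem row_mem_and_col_mem_of_mem_span_outerSet {U : Submodule F (ι → F)} {V : Submodule F (κ → F)}
    {N : Matrix ι κ F} (hN : N ∈ Submodule.span F (outerSet U V)) :
    (∀ i, N.row i ∈ V) ∧ (∀ j, N.col j ∈ U) := by
  induction hN using Submodule.span_induction with
  | mem N hN =>
    obtain ⟨u, hu, v, hv, rfl⟩ := hN
    refine ⟨fun i => ?_, fun j => ?_⟩
    · have : (Matrix.vecMulVec u v).row i = u i • v := by
        funext l; simp [Matrix.row, Matrix.vecMulVec_apply]
      rw [this]; exact V.smul_mem _ hv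
    · have : (Matrix.vecMulVec u v).col j = v j • u := by
        funext l; simp [Matrix.col, Matrix.vecMulVec_apply, mul_comm]
      rw [this]; exact U.smul_mem _ hu
  | zero => exact ⟨fun i => V.zero_mem, fun j => U.zero_mem⟩
  | add N N' _ _ h h' =>
    exact ⟨fun i => V.add_mem (h.1 i) (h'.1 i), fun j => U.add_mem (h.2 j) (h'.2 j)⟩
  | smul a N _ h => exact ⟨fun i => V.smul_mem a (h.1 i), fun j => U.smul_mem a (h.2 j)⟩

/-- **EGOW 2018, Proposition 2.8, upper bound:** every matrix in `span(U ⊗ V)` has rank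
`≤ min(dim U, dim V)`. [cite: EfremenkoGargOliveiraWigderson2018, Prop 2.8, p. 9] locator: paper:arxiv-1710.09502 p0009.txt:L21 -/
theorem rank_le_of_mem_span_outerSet {U : Submodule F (ι → F)} {V : Submodule F (κ → F)}
    {N : Matrix ι κ F} (hN : N ∈ Submodule.span F (outerSet U V)) :
    N.rank ≤ min (Module.finrank F U) (Module.finrank F V) := by
  obtain ⟨hrow, hcol⟩ := row_mem_and_col_mem_of_mem_span_outerSet hN
  refine le_min ?_ ?_
  · rw [Matrix.rank_eq_finrank_span_cols]
    exact Submodule.finrank_mono (Submodule.span_le.2 (by rintro _ ⟨j, rfl⟩; exact hcol j))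
  · rw [Matrix.rank_eq_finrank_span_row]
    exact Submodule.finrank_mono (Submodule.span_le.2 (by rintro _ ⟨i, rfl⟩; exact hrow i))

omit [Fintype ι] in
/-- A sum `∑_{k < t} u_k ⊗ v_k` with `u`, `v` linearly independent has rank `t` (the lower bound in
Prop 2.8's equality `rk(span(U ⊗ V)) = min(r, s)`). [cite: EfremenkoGargOliveiraWigderson2018, Prop 2.8 (proof), p. 9] locator: paper:arxiv-1710.09502 p0009.txt:L28 -/
theorem rank_sum_vecMulVec_eq {t : ℕ} (u : Fin t → ι → F) (v : Fin t → κ → F)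
    (hu : LinearIndependent F u) (hv : LinearIndependent F v) :
    (∑ k, Matrix.vecMulVec (u k) (v k)).rank = t := by
  classical
  set A : Matrix ι (Fin t) F := Matrix.of fun i k => u k i with hA
  set B : Matrix (Fin t) κ F := Matrix.of fun k l => v k l with hB
  have hAB : ∑ k, Matrix.vecMulVec (u k) (v k) = A * B := by
    ext i l
    simp [Matrix.sum_apply, Matrix.vecMulVec_apply, Matrix.mul_apply, hA, hB]
  have hArank : A.rank = t := by
    have hcols : A.col = u := by funext k i; rfl
    rw [Matrix.rank_eq_finrank_span_cols, hcols, finrank_span_eq_card hu, Fintype.card_fin]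
  have hBrank : B.rank = t := by
    have hrows : B.row = v := by funext k l; rfl
    rw [Matrix.rank_eq_finrank_span_row, hrows, finrank_span_eq_card hv, Fintype.card_fin]
  have hBsurj : LinearMap.range B.mulVecLin = ⊤ := by
    apply Submodule.eq_top_of_finrank_eq
    rw [Module.finrank_fintype_fun_eq_card, Fintype.card_fin]
    exact hBrank
  rw [hAB, Matrix.rank, Matrix.mulVecLin_mul, LinearMap.range_comp_of_range_eq_top _ hBsurj]
  exact hArank

/-- **EGOW 2018, Proposition 2.8, as printed (equality).** For vector spaces `U ⊆ F^ι`, `V ⊆ F^κ`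
of dimensions `r` and `s`, the space of matrices `𝓜 = span(U ⊗ V)` has `rk(𝓜) = min(r, s)`.
[cite: EfremenkoGargOliveiraWigderson2018, Prop 2.8, p. 9] locator: paper:arxiv-1710.09502 p0009.txt:L21 -/
theorem EGOW2018_prop28 (U : Submodule F (ι → F)) (V : Submodule F (κ → F)) :
    matrixSetRank (Submodule.span F (outerSet U V) : Set (Matrix ι κ F)) =
      min (Module.finrank F U) (Module.finrank F V) := by
  classical
  refine le_antisymm (matrixSetRank_le fun N hN => rank_le_of_mem_span_outerSet hN) ?_
  set t := min (Module.finrank F U) (Module.finrank F V) with ht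
  let bU := Module.finBasis F U
  let bV := Module.finBasis F V
  let u : Fin t → ι → F := fun k => (bU (Fin.castLE (min_le_left _ _) k) : ι → F)
  let v : Fin t → κ → F := fun k => (bV (Fin.castLE (min_le_right _ _) k) : κ → F)
  have hu : LinearIndependent F u :=
    (bU.linearIndependent.map' U.subtype (Submodule.ker_subtype U)).comp _
      (Fin.castLE_injective _)
  have hv : LinearIndependent F v :=
    (bV.linearIndependent.map' V.subtype (Submodule.ker_subtype V)).comp _
      (Fin.castLE_injective _)
  have hmem : ∑ k, Matrix.vecMulVec (u k) (v k) ∈ Submodule.span F (outerSet U V) :=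
    Submodule.sum_mem _ fun k _ => Submodule.subset_span
      ⟨u k, (bU _).2, v k, (bV _).2, rfl⟩
  calc t = (∑ k, Matrix.vecMulVec (u k) (v k)).rank := (rank_sum_vecMulVec_eq u v hu hv).symm
    _ ≤ _ := rank_le_matrixSetRank hmem

/-- **Dimension of a coefficient space through the monomial count**: if every `f_i` has its
monomials in the finite set `S` then `dim 𝒞(f) ≤ |S|` (the argument of Prop 2.10 / Prop 2.12).
[cite: EfremenkoGargOliveiraWigderson2018, Prop 2.10 (proof idea), p. 9] locator: paper:arxiv-1710.09502 p0009.txt:L63 -/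
theorem finrank_coeffSpaceVec_le_card (f : ι → MvPolynomial σ F) (S : Finset (σ →₀ ℕ))
    (hf : ∀ i, (f i).support ⊆ S) : Module.finrank F (coeffSpaceVec f) ≤ S.card := by
  classical
  have hle : coeffSpaceVec f ≤
      Submodule.span F (S.image fun e : σ →₀ ℕ => fun i => coeff e (f i) : Set (ι → F)) := by
    refine Submodule.span_le.2 ?_
    rintro _ ⟨e, rfl⟩
    by_cases he : e ∈ S
    · exact Submodule.subset_span (Finset.mem_coe.2 (Finset.mem_image_of_mem _ he))
    · have h0 : (fun i => coeff e (f i)) = 0 := by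
        funext i
        exact MvPolynomial.notMem_support_iff.1 fun h => he (hf i h)
      change (fun i => coeff e (f i)) ∈ _
      rw [h0]; exact Submodule.zero_mem _
  refine (Submodule.finrank_mono hle).trans ?_
  exact (finrank_span_finset_le_card _).trans Finset.card_image_le

/-- **EGOW 2018, Proposition 2.10.** If `f ∈ F[x_1, …, x_n]^ι` is a vector of homogeneous polynomials
of degree `d` (`n ≥ 1`), then `dim 𝒞(f) ≤ C(n+d−1, n−1)` (the number of monomials of degree `d`).
[cite: EfremenkoGargOliveiraWigderson2018, Prop 2.10, p. 9] locator: paper:arxiv-1710.09502 p0009.txt:L63 -/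
theorem EGOW2018_prop210 {n d : ℕ} (hn : 0 < n) (f : ι → MvPolynomial (Fin n) F)
    (hf : ∀ i, (f i).IsHomogeneous d) :
    Module.finrank F (coeffSpaceVec f) ≤ (n + d - 1).choose (n - 1) := by
  classical
  obtain ⟨n', rfl⟩ : ∃ n', n = n' + 1 := ⟨n - 1, by omega⟩
  have hS : ∀ i, (f i).support ⊆ (Finset.univ : Finset (Fin (n' + 1))).finsuppAntidiag d := by
    intro i e he
    rw [Finset.mem_finsuppAntidiag]
    refine ⟨?_, Finset.subset_univ _⟩
    have h := hf i (MvPolynomial.mem_support_iff.1 he)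
    rw [weight_one_eq_degree, Finsupp.degree_eq_sum] at h
    exact h
  refine (finrank_coeffSpaceVec_le_card f _ hS).trans ?_
  have h := card_finsuppAntidiag_univ_le (n := n') d
  have e1 : n' + 1 + d - 1 = n' + d := by omega
  have e2 : n' + 1 - 1 = n' := by omega
  rw [e1, e2]
  exact h

omit [Fintype ι] [Fintype κ] in
/-- The coefficient matrices of `f ⊗ g` lie in `span(𝒞(f) ⊗ 𝒞(g))`:
`(f ⊗ g)_e = ∑_{e₁ + e₂ = e} f_{e₁} ⊗ g_{e₂}`. [cite: EfremenkoGargOliveiraWigderson2018, Cor 2.11 (proof), p. 9] locator: paper:arxiv-1710.09502 p0009.txt:L69 -/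
theorem coeffSpace_vecMulVec_le (f : ι → MvPolynomial σ F) (g : κ → MvPolynomial σ F) :
    coeffSpace (Matrix.vecMulVec f g) ≤
      Submodule.span F (outerSet (coeffSpaceVec f) (coeffSpaceVec g)) := by
  classical
  refine Submodule.span_le.2 ?_
  rintro _ ⟨e, rfl⟩
  have hexp : (Matrix.vecMulVec f g).map (coeff e) =
      ∑ x ∈ Finset.antidiagonal e,
        Matrix.vecMulVec (fun i => coeff x.1 (f i)) (fun j => coeff x.2 (g j)) := by
    ext i j
    simp [Matrix.map_apply, Matrix.vecMulVec_apply, Matrix.sum_apply, coeff_mul]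
  change (Matrix.vecMulVec f g).map (coeff e) ∈ _
  rw [hexp]
  exact Submodule.sum_mem _ fun x _ => Submodule.subset_span
    ⟨_, coeffVec_mem_coeffSpaceVec f x.1, _, coeffVec_mem_coeffSpaceVec g x.2, rfl⟩

/-- **EGOW 2018, Corollary 2.11.** For vectors `f, g ∈ F[x_1, …, x_n]^*` of homogeneous polynomials
of degrees `d_f`, `d_g` (`n ≥ 1`): `rk(𝒞(f ⊗ g)) ≤ min{C(n+d_f−1, n−1), C(n+d_g−1, n−1)}`.
[cite: EfremenkoGargOliveiraWigderson2018, Cor 2.11, p. 9] locator: paper:arxiv-1710.09502 p0009.txt:L72 -/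
theorem EGOW2018_cor211 {n df dg : ℕ} (hn : 0 < n)
    (f : ι → MvPolynomial (Fin n) F) (g : κ → MvPolynomial (Fin n) F)
    (hf : ∀ i, (f i).IsHomogeneous df) (hg : ∀ j, (g j).IsHomogeneous dg) :
    matrixSetRank (coeffSpace (Matrix.vecMulVec f g) : Set (Matrix ι κ F)) ≤
      min ((n + df - 1).choose (n - 1)) ((n + dg - 1).choose (n - 1)) := by
  calc matrixSetRank (coeffSpace (Matrix.vecMulVec f g) : Set (Matrix ι κ F))
      ≤ matrixSetRank (Submodule.span F (outerSet (coeffSpaceVec f) (coeffSpaceVec g)) :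
          Set (Matrix ι κ F)) := matrixSetRank_mono (coeffSpace_vecMulVec_le f g)
    _ = min (Module.finrank F (coeffSpaceVec f)) (Module.finrank F (coeffSpaceVec g)) :=
          EGOW2018_prop28 _ _
    _ ≤ _ := min_le_min (EGOW2018_prop210 hn f hf)
          (EGOW2018_prop210 hn g hg)

/-- The set-multilinear monomial selecting the variable `x_{j, g j}` in each block `j ∈ S`
(blocks `x_j = (x_{j,1}, …, x_{j,n})`, `j < d`). [cite: EfremenkoGargOliveiraWigderson2018, Prop 2.12 (proof idea), p. 9] locator: paper:arxiv-1710.09502 p0009.txt:L85 -/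
def transversalMonomial {d n : ℕ} (S : Finset (Fin d)) (g : S → Fin n) : Fin d × Fin n →₀ ℕ :=
  ∑ j : S, Finsupp.single ((j : Fin d), g j) 1

/-- **Set-multilinear monomials are transversals.** A monomial in the variables `x_{j,i}`
(`j < d`, `i < n`) whose block-degree vector is the indicator of `S` (set-multilinear over the blocks
`S` for the block map `Prod.fst`) is `∏_{j ∈ S} x_{j, g j}` for some choice function `g` (the monomial
count behind Prop 2.12's `n^d`). [cite: EfremenkoGargOliveiraWigderson2018, Prop 2.12 (proof), p. 9] locator: paper:arxiv-1710.09502 p0009.txt:L85 -/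
theorem exists_eq_transversalMonomial {d n : ℕ} (S : Finset (Fin d)) (e : Fin d × Fin n →₀ ℕ)
    (he : weight (blockWeight (Prod.fst : Fin d × Fin n → Fin d)) e = blockProfile S) :
    ∃ g : S → Fin n, e = transversalMonomial S g := by
  classical
  induction e using Finsupp.induction generalizing S with
  | zero =>
    rw [map_zero, eq_comm, blockProfile_eq_zero_iff] at he
    subst he
    exact ⟨fun j => absurd j.2 (Finset.notMem_empty _), by simp [transversalMonomial]⟩
  | single_add a b e ha hb ih =>
    rw [map_add, weight_blockWeight_single] at he
    obtain ⟨hsub, hA, hB⟩ := (add_eq_blockProfile_iff _ _ S).1 he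
    have hsupp : (Finsupp.single a.1 b).support = {a.1} := Finsupp.support_single _ hb
    rw [hsupp] at hsub hA hB
    have ha1 : a.1 ∈ S := hsub (Finset.mem_singleton_self _)
    have hb1 : b = 1 := by
      have := DFunLike.congr_fun hA a.1
      simpa using this
    subst hb1
    obtain ⟨g', hg'⟩ := ih (S \ {a.1}) hB
    refine ⟨fun j => if h : (j : Fin d) = a.1 then a.2 else g' ⟨j, Finset.mem_sdiff.2 ⟨j.2, by
      simpa using h⟩⟩, ?_⟩
    -- split the transversal sum at the block `a.1`
    have key : ∀ (T : Finset (Fin d)) (G : T → Fin n),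
        transversalMonomial T G = ∑ j ∈ T, if h : j ∈ T then Finsupp.single (j, G ⟨j, h⟩) 1 else 0 := by
      intro T G
      rw [transversalMonomial, ← Finset.sum_coe_sort T]
      refine Finset.sum_congr rfl fun j _ => ?_
      rw [dif_pos j.2]
    rw [key] at hg'
    rw [key, Finset.sum_eq_add_sum_sdiff_singleton_of_mem ha1, dif_pos ha1]
    dsimp only
    rw [dif_pos rfl]
    congr 1
    rw [hg']
    refine Finset.sum_congr rfl fun j hj => ?_
    have hjS : j ∈ S := (Finset.mem_sdiff.1 hj).1
    have hja : j ≠ a.1 := by simpa using (Finset.mem_sdiff.1 hj).2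
    rw [dif_pos hj, dif_pos hjS, dif_neg hja]

/-- **EGOW 2018, Proposition 2.12** (for a sub-family `S` of the blocks, as Cor 2.13 uses it; the
printed case is `S = [d]`, bound `n^d`). If every `f_i ∈ F[x]`, `x = (x_1, …, x_d)` with `n`
variables per block, is homogeneous set-multilinear with respect to the blocks `(x_j)_{j ∈ S}`, then
`dim 𝒞(f) ≤ n^{|S|}`. [cite: EfremenkoGargOliveiraWigderson2018, Prop 2.12, p. 9] locator: paper:arxiv-1710.09502 p0009.txt:L85 -/
theorem finrank_coeffSpaceVec_le_pow {d n : ℕ} (S : Finset (Fin d))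
    (f : ι → MvPolynomial (Fin d × Fin n) F)
    (hf : ∀ i, IsSetMultilinear (Prod.fst : Fin d × Fin n → Fin d) S (f i)) :
    Module.finrank F (coeffSpaceVec f) ≤ n ^ S.card := by
  classical
  let T : Finset (Fin d × Fin n →₀ ℕ) :=
    (Finset.univ : Finset (S → Fin n)).image (transversalMonomial S)
  have hT : ∀ i, (f i).support ⊆ T := by
    intro i e he
    obtain ⟨g, rfl⟩ := exists_eq_transversalMonomial S e (hf i (MvPolynomial.mem_support_iff.1 he))
    exact Finset.mem_image_of_mem _ (Finset.mem_univ _)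
  refine (finrank_coeffSpaceVec_le_card f T hT).trans (Finset.card_image_le.trans ?_)
  simp

/-- The printed case `S = [d]` of Prop 2.12: `dim 𝒞(f) ≤ n^d`. [cite: EfremenkoGargOliveiraWigderson2018, Prop 2.12, p. 9] locator: paper:arxiv-1710.09502 p0009.txt:L91 -/
theorem EGOW2018_prop212 {d n : ℕ} (f : ι → MvPolynomial (Fin d × Fin n) F)
    (hf : ∀ i, IsSetMultilinear (Prod.fst : Fin d × Fin n → Fin d) Finset.univ (f i)) :
    Module.finrank F (coeffSpaceVec f) ≤ n ^ d := by
  simpa using finrank_coeffSpaceVec_le_pow Finset.univ f hf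

/-- **EGOW 2018, Corollary 2.13.** With `x = (x_1, …, x_d)`, `n` variables per block, and a
partition `S_f ⊔ S_g = [d]`, `|S_f| = d_f`, `|S_g| = d_g`: if `f`, `g` are vectors of homogeneous
set-multilinear polynomials with respect to `(x_j)_{j ∈ S_f}`, resp. `(x_j)_{j ∈ S_g}`, then
`rk(𝒞(f ⊗ g)) ≤ min{n^{d_f}, n^{d_g}}` (only the two set-multilinearity hypotheses are used).
[cite: EfremenkoGargOliveiraWigderson2018, Cor 2.13, p. 9] locator: paper:arxiv-1710.09502 p0009.txt:L96 -/
theorem EGOW2018_cor213 {d n : ℕ} (Sf Sg : Finset (Fin d))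
    (f : ι → MvPolynomial (Fin d × Fin n) F) (g : κ → MvPolynomial (Fin d × Fin n) F)
    (hf : ∀ i, IsSetMultilinear (Prod.fst : Fin d × Fin n → Fin d) Sf (f i))
    (hg : ∀ j, IsSetMultilinear (Prod.fst : Fin d × Fin n → Fin d) Sg (g j)) :
    matrixSetRank (coeffSpace (Matrix.vecMulVec f g) : Set (Matrix ι κ F)) ≤
      min (n ^ Sf.card) (n ^ Sg.card) := by
  calc matrixSetRank (coeffSpace (Matrix.vecMulVec f g) : Set (Matrix ι κ F))
      ≤ matrixSetRank (Submodule.span F (outerSet (coeffSpaceVec f) (coeffSpaceVec g)) :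
          Set (Matrix ι κ F)) := matrixSetRank_mono (coeffSpace_vecMulVec_le f g)
    _ = min (Module.finrank F (coeffSpaceVec f)) (Module.finrank F (coeffSpaceVec g)) :=
          EGOW2018_prop28 _ _
    _ ≤ _ := min_le_min (finrank_coeffSpaceVec_le_pow Sf f hf) (finrank_coeffSpaceVec_le_pow Sg g hg)

end CoefficientSpaces

/-! ## §3: homogeneous rank and set-multilinear rank (Def 3.1, Lemma 3.3, Def 3.4, Lemma 3.5) -/

section RestrictedRank

variable {F : Type*} [Field F] {σ : Type*} {ι : Type*} [Fintype ι]

omit [Fintype ι] in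
/-- A product `K · N` of an `ι × ρ` and a `ρ × ι` matrix is the sum of the `ρ` rank-one matrices
`K[·, k] ⊗ N[k, ·]` ("`M = M_1 + … + M_r`, where each `M_i = u_i ⊗ v_i`", EGOW 2018, §3, p. 10).
[cite: EfremenkoGargOliveiraWigderson2018, §3, p. 10] locator: paper:arxiv-1710.09502 p0010.txt:L3 -/
theorem mul_eq_sum_vecMulVec {R : Type*} [CommSemiring R] {ρ : ℕ} (K : Matrix ι (Fin ρ) R)
    (N : Matrix (Fin ρ) ι R) :
    K * N = ∑ k, Matrix.vecMulVec (fun i => K i k) (fun j => N k j) := by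
  ext i j
  simp [Matrix.mul_apply, Matrix.sum_apply, Matrix.vecMulVec_apply]

/-- **EGOW 2018, Definition 3.1 (Homogeneous Rank).** For a matrix `M(x) ∈ Mat_ι(F[x])` (in the
paper: of homogeneous polynomials of degree `d`), `hrk(M(x))` is the minimum `r` such that
`M(x) = ∑_{i ≤ r} u_i(x) ⊗ v_i(x)` where each `u_i(x), v_i(x) ∈ F[x]^ι` is a vector whose entries are
homogeneous polynomials of one common degree (`d_{u_i}`, resp. `d_{v_i}`). As an infimum in `ℕ`
(value `0` on the empty set; under the hypotheses of Lemma 3.3 a decomposition exists,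
`EGOW2018_lem33`). [cite: EfremenkoGargOliveiraWigderson2018, Def 3.1, p. 10] locator: paper:arxiv-1710.09502 p0010.txt:L26 -/
def homogRank (M : Matrix ι ι (MvPolynomial σ F)) : ℕ :=
  sInf {r | ∃ (u v : Fin r → ι → MvPolynomial σ F) (du dv : Fin r → ℕ),
    (∀ k i, (u k i).IsHomogeneous (du k)) ∧ (∀ k i, (v k i).IsHomogeneous (dv k)) ∧
      M = ∑ k, Matrix.vecMulVec (u k) (v k)}

omit [Fintype ι] in
/-- A homogeneous rank-one decomposition indexed by any finite type `K` bounds `hrk` by `|K|`.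
[cite: EfremenkoGargOliveiraWigderson2018, Def 3.1, p. 10] locator: paper:arxiv-1710.09502 p0010.txt:L28 -/
theorem homogRank_le_card {K : Type*} [Fintype K] (M : Matrix ι ι (MvPolynomial σ F))
    (u v : K → ι → MvPolynomial σ F) (du dv : K → ℕ) (hu : ∀ k i, (u k i).IsHomogeneous (du k))
    (hv : ∀ k i, (v k i).IsHomogeneous (dv k)) (hM : M = ∑ k, Matrix.vecMulVec (u k) (v k)) :
    homogRank M ≤ Fintype.card K := by
  classical
  let e := Fintype.equivFin K
  refine Nat.sInf_le ⟨u ∘ e.symm, v ∘ e.symm, du ∘ e.symm, dv ∘ e.symm, fun k i => hu _ i,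
    fun k i => hv _ i, ?_⟩
  rw [hM]
  exact (Equiv.sum_comp e.symm (fun k => Matrix.vecMulVec (u k) (v k))).symm

/-- Any decomposition of `M(x)` into `r'` rank-one matrices `u_k(x) ⊗ v_k(x)` with POLYNOMIAL
vectors bounds the symbolic rank: `rk_{F(x)}(M) ≤ r'` (so `rk ≤ hrk` and `rk ≤ smrk` whenever these are
attained; §3, p. 10: the restricted decompositions "impose additional conditions" on the rank-one
pieces). [cite: EfremenkoGargOliveiraWigderson2018, §3, p. 10] locator: paper:arxiv-1710.09502 p0010.txt:L9 -/
theorem symbolicRank_le_of_eq_sum_vecMulVec {K : Type*} [Fintype K] (M : Matrix ι ι (MvPolynomial σ F))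
    (u v : K → ι → MvPolynomial σ F) (hM : M = ∑ k, Matrix.vecMulVec (u k) (v k)) :
    symbolicRank M ≤ Fintype.card K := by
  classical
  let φ := algebraMap (MvPolynomial σ F) (FractionRing (MvPolynomial σ F))
  have hmap : M.map φ = ∑ k, Matrix.vecMulVec (φ ∘ u k) (φ ∘ v k) := by
    ext i j
    simp [hM, Matrix.sum_apply, Matrix.vecMulVec_apply, φ]
  unfold symbolicRank
  rw [hmap]
  refine (matrix_rank_sum_le _ _).trans ?_
  calc ∑ k, (Matrix.vecMulVec (φ ∘ u k) (φ ∘ v k)).rank ≤ ∑ _k : K, 1 :=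
        Finset.sum_le_sum fun k _ => Matrix.rank_vecMulVec_le _ _
    _ = Fintype.card K := by simp

variable [Infinite F] [DecidableEq σ]

/-- **EGOW 2018, Lemma 3.3, pointwise-rank form** (the form in which Theorem 4.2 invokes it, via
Lemma 2.7): if the entries of `M(x)` are homogeneous of degree `d` and every evaluation `M(a)` has
rank `≤ r`, then `hrk(M(x)) ≤ r · (d + 1)` (infinite `F`). Proof = the tree's weighted
decomposition `exists_weighted_decomposition` (Lemma 3.2 + "decomposing into homogeneous
components") with the `d + 1` splittings `k + (d − k) = d`. [cite: EfremenkoGargOliveiraWigderson2018, Lemma 3.3, p. 10] locator: paper:arxiv-1710.09502 p0010.txt:L105 -/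
theorem homogRank_le_of_forall_rank_le (M : Matrix ι ι (MvPolynomial σ F)) {d r : ℕ}
    (hM : ∀ i j, (M i j).IsHomogeneous d) (hr : ∀ a : σ → F, (M.map (eval a)).rank ≤ r) :
    homogRank M ≤ r * (d + 1) := by
  classical
  let g : ℕ → ℕ × ℕ := fun k => (k, d - k)
  let T : Finset (ℕ × ℕ) := (Finset.range (d + 1)).image g
  have hT : ∀ x ∈ T, x.1 + x.2 = d := by
    intro x hx
    obtain ⟨k, hk, rfl⟩ := Finset.mem_image.1 hx
    have hk' := Finset.mem_range.1 hk
    change k + (d - k) = d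
    omega
  have hT' : ∀ s t : σ →₀ ℕ, weight (1 : σ → ℕ) s + weight (1 : σ → ℕ) t = d →
      (weight (1 : σ → ℕ) s, weight (1 : σ → ℕ) t) ∈ T := by
    intro s t hst
    refine Finset.mem_image.2 ⟨weight (1 : σ → ℕ) s, Finset.mem_range.2 (by omega), ?_⟩
    change (weight (1 : σ → ℕ) s, d - weight (1 : σ → ℕ) s) = _
    ext
    · rfl
    · change d - weight (1 : σ → ℕ) s = weight (1 : σ → ℕ) t
      omega
  obtain ⟨ρ, a, K, N, hρ, hK, hN, hdec⟩ :=
    exists_weighted_decomposition (1 : σ → ℕ) (AddMonoidHom.id ℕ) (fun _ => rfl) d T hT hT' M hM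
  have hρr : ρ ≤ r := hρ.trans (hr a)
  have hginj : Set.InjOn g (Finset.range (d + 1) : Set ℕ) := fun k _ k' _ h => (Prod.ext_iff.1 h).1
  have hdec' : M = ∑ p : Fin (d + 1) × Fin ρ,
      Matrix.vecMulVec (fun i => K (p.1 : ℕ) i p.2) (fun j => N (d - p.1) p.2 j) := by
    rw [hdec, Finset.sum_image hginj, Finset.sum_range (fun k => K (g k).1 * N (g k).2),
      Fintype.sum_prod_type]
    exact Finset.sum_congr rfl fun k _ => mul_eq_sum_vecMulVec _ _
  calc homogRank M ≤ Fintype.card (Fin (d + 1) × Fin ρ) :=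
        homogRank_le_card M _ _ (fun p => (p.1 : ℕ)) (fun p => d - (p.1 : ℕ)) (fun p i => hK _ i _)
          (fun p j => hN _ _ j) hdec'
    _ = (d + 1) * ρ := by simp
    _ ≤ (d + 1) * r := Nat.mul_le_mul_left _ hρr
    _ = r * (d + 1) := Nat.mul_comm _ _

/-- **EGOW 2018, Lemma 3.3 (Matrix Rank Over Polynomial Rings), as printed.** If each entry of
`M(x) ∈ Mat(F[x])` is a homogeneous polynomial of degree `d` and `rk_{F(x)}(M(x)) ≤ r`, then
`hrk(M(x)) ≤ r · (d + 1)` (infinite `F`; paper: characteristic zero). [cite: EfremenkoGargOliveiraWigderson2018, Lemma 3.3, p. 10] locator: paper:arxiv-1710.09502 p0010.txt:L109 -/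
theorem EGOW2018_lem33 (M : Matrix ι ι (MvPolynomial σ F)) {d r : ℕ}
    (hM : ∀ i j, (M i j).IsHomogeneous d) (h : symbolicRank M ≤ r) :
    homogRank M ≤ r * (d + 1) :=
  homogRank_le_of_forall_rank_le M hM fun b => (rank_map_eval_le_symbolicRank M b).trans h

omit [Infinite F] [DecidableEq σ]

/-- **EGOW 2018, Definition 3.4 (Set-Multilinear Rank).** Variables `x = (x_1, …, x_d)`, `n` per
block (`Fin d × Fin n`, block map `Prod.fst`). For a matrix `M(x)` (in the paper: of homogeneous
set-multilinear polynomials of degree `d`), `smrk(M(x))` is the least `r` such that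
`M(x) = ∑_{i ≤ r} f_i(x) ⊗ g_i(x)` with `f_i` set-multilinear with respect to `(x_j)_{j ∈ S_i}` and `g_i`
with respect to `(x_j)_{j ∈ [d] ∖ S_i}` for some `S_i ⊆ [d]` (the printed partition
`S_f^i ⊔ S_g^i = [d]`; in particular `deg f_i + deg g_i = d`). Infimum in `ℕ` (`0` on the empty set;
under the hypotheses of Lemma 3.5 a decomposition exists, `EGOW2018_lem35`).
[cite: EfremenkoGargOliveiraWigderson2018, Def 3.4, p. 11] locator: paper:arxiv-1710.09502 p0011.txt:L19 -/
def smlRank {d n : ℕ} (M : Matrix ι ι (MvPolynomial (Fin d × Fin n) F)) : ℕ :=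
  sInf {r | ∃ (u v : Fin r → ι → MvPolynomial (Fin d × Fin n) F) (S : Fin r → Finset (Fin d)),
    (∀ k i, IsSetMultilinear (Prod.fst : Fin d × Fin n → Fin d) (S k) (u k i)) ∧
      (∀ k i, IsSetMultilinear (Prod.fst : Fin d × Fin n → Fin d) (S k)ᶜ (v k i)) ∧
        M = ∑ k, Matrix.vecMulVec (u k) (v k)}

omit [Fintype ι] in
/-- A set-multilinear rank-one decomposition indexed by any finite type `K` bounds `smrk` by `|K|`.
[cite: EfremenkoGargOliveiraWigderson2018, Def 3.4, p. 11] locator: paper:arxiv-1710.09502 p0011.txt:L25 -/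
theorem smlRank_le_card {d n : ℕ} {K : Type*} [Fintype K]
    (M : Matrix ι ι (MvPolynomial (Fin d × Fin n) F)) (u v : K → ι → MvPolynomial (Fin d × Fin n) F)
    (S : K → Finset (Fin d))
    (hu : ∀ k i, IsSetMultilinear (Prod.fst : Fin d × Fin n → Fin d) (S k) (u k i))
    (hv : ∀ k i, IsSetMultilinear (Prod.fst : Fin d × Fin n → Fin d) (S k)ᶜ (v k i))
    (hM : M = ∑ k, Matrix.vecMulVec (u k) (v k)) : smlRank M ≤ Fintype.card K := by
  classical
  let e := Fintype.equivFin K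
  refine Nat.sInf_le ⟨u ∘ e.symm, v ∘ e.symm, S ∘ e.symm, fun k i => hu _ i, fun k i => hv _ i, ?_⟩
  rw [hM]
  exact (Equiv.sum_comp e.symm (fun k => Matrix.vecMulVec (u k) (v k))).symm

variable [Infinite F]

/-- **EGOW 2018, Lemma 3.5, pointwise-rank form** (as invoked in the proof of Theorem 4.4 through
Lemma 2.7): if `M(x)` is set-multilinear of degree `d` for the partition `x = (x_1, …, x_d)` and every
evaluation has rank `≤ r`, then `smrk(M(x)) ≤ r · 2^d` (infinite `F`). Proof = the tree's weighted
decomposition theorem with the `2^d` splittings `S ⊔ ([d] ∖ S)` (`add_eq_blockProfile_iff`).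
[cite: EfremenkoGargOliveiraWigderson2018, Lemma 3.5, p. 11] locator: paper:arxiv-1710.09502 p0011.txt:L48 -/
theorem smlRank_le_of_forall_rank_le {d n : ℕ} (M : Matrix ι ι (MvPolynomial (Fin d × Fin n) F))
    {r : ℕ} (hM : ∀ i j, IsSetMultilinear (Prod.fst : Fin d × Fin n → Fin d) Finset.univ (M i j))
    (hr : ∀ a : Fin d × Fin n → F, (M.map (eval a)).rank ≤ r) :
    smlRank M ≤ r * 2 ^ d := by
  classical
  let w := blockWeight (Prod.fst : Fin d × Fin n → Fin d)
  let g : Finset (Fin d) → (Fin d →₀ ℕ) × (Fin d →₀ ℕ) := fun S => (blockProfile S, blockProfile Sᶜ)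
  let T : Finset ((Fin d →₀ ℕ) × (Fin d →₀ ℕ)) := (Finset.univ : Finset (Finset (Fin d))).image g
  have hcompl : ∀ S : Finset (Fin d), blockProfile S + blockProfile Sᶜ = blockProfile Finset.univ := by
    intro S
    rw [Finset.compl_eq_univ_sdiff, blockProfile_add_sdiff (Finset.subset_univ S)]
  have hT : ∀ x ∈ T, x.1 + x.2 = blockProfile Finset.univ := by
    intro x hx
    obtain ⟨S, -, rfl⟩ := Finset.mem_image.1 hx
    exact hcompl S
  have hT' : ∀ s t : Fin d × Fin n →₀ ℕ, weight w s + weight w t = blockProfile Finset.univ →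
      (weight w s, weight w t) ∈ T := by
    intro s t hst
    obtain ⟨-, hA, hB⟩ := (add_eq_blockProfile_iff _ _ _).1 hst
    refine Finset.mem_image.2 ⟨(weight w s).support, Finset.mem_univ _, ?_⟩
    change (blockProfile (weight w s).support, blockProfile (weight w s).supportᶜ) = _
    rw [Finset.compl_eq_univ_sdiff, ← hA, ← hB]
  have hφ : ∀ v : Fin d × Fin n, Finsupp.degree (w v) = 1 := fun v => by
    simp [w, blockWeight]
  obtain ⟨ρ, a, K, N, hρ, hK, hN, hdec⟩ :=
    exists_weighted_decomposition w Finsupp.degree hφ (blockProfile Finset.univ) T hT hT' M hM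
  have hρr : ρ ≤ r := hρ.trans (hr a)
  have hginj : Set.InjOn g ((Finset.univ : Finset (Finset (Fin d))) : Set (Finset (Fin d))) :=
    fun S _ S' _ h => blockProfile_injective (Prod.ext_iff.1 h).1
  have hdec' : M = ∑ p : Finset (Fin d) × Fin ρ,
      Matrix.vecMulVec (fun i => K (blockProfile p.1) i p.2) (fun j => N (blockProfile p.1ᶜ) p.2 j) := by
    rw [hdec, Finset.sum_image hginj, Fintype.sum_prod_type]
    exact Finset.sum_congr rfl fun S _ => mul_eq_sum_vecMulVec _ _
  calc smlRank M ≤ Fintype.card (Finset (Fin d) × Fin ρ) :=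
        smlRank_le_card M _ _ (fun p => p.1) (fun p i => hK _ i _) (fun p j => hN _ _ j) hdec'
    _ = 2 ^ d * ρ := by simp [Fintype.card_finset]
    _ ≤ 2 ^ d * r := Nat.mul_le_mul_left _ hρr
    _ = r * 2 ^ d := Nat.mul_comm _ _

/-- **EGOW 2018, Lemma 3.5 (Set-Multilinear Rank of Polynomial Matrices), as printed.** If
`M(x) ∈ Mat(F[x])` is a set-multilinear matrix of degree `d` with partition `x = (x_1, …, x_d)` and
`rk_{F(x)}(M(x)) ≤ r`, then `smrk(M(x)) ≤ r · 2^d` (infinite `F`; paper: characteristic zero).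
[cite: EfremenkoGargOliveiraWigderson2018, Lemma 3.5, p. 11] locator: paper:arxiv-1710.09502 p0011.txt:L52 -/
theorem EGOW2018_lem35 {d n : ℕ} (M : Matrix ι ι (MvPolynomial (Fin d × Fin n) F)) {r : ℕ}
    (hM : ∀ i j, IsSetMultilinear (Prod.fst : Fin d × Fin n → Fin d) Finset.univ (M i j))
    (h : symbolicRank M ≤ r) : smlRank M ≤ r * 2 ^ d :=
  smlRank_le_of_forall_rank_le M hM fun b => (rank_map_eval_le_symbolicRank M b).trans h

end RestrictedRank

/-! ## §5: the proposed rank-method instantiation for (non-homogeneous) depth-3 formulas -/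

section DepthThree

variable {F : Type*} [Field F] {n : ℕ}

/-- **The depth-3 normal form of §5.** "A depth-3 formula (not necessarily homogeneous) computing a
homogeneous polynomial `f(x)` of degree `d` can be written as `f(x) = ∑_{i=1}^{s} α_i ∏_{j=1}^{D} (1 + ℓ_{ij}(x))`,
where each `α_i ∈ F`, `ℓ_{ij}` is a linear form … and `D` is the maximum degree of a gate";
"The size of our formula is given by `s + D`". `HasDepthThreeForm f s D` records such a representation
with top fan-in `s` and product fan-in `D` (linear forms by coefficient vectors, tree `linearForm`).
Scope note: this is the paper's MODEL of §5 verbatim; a general `ΣΠΣ` formula whose affine forms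
have zero constant terms is not literally of this shape (the paper does not discuss the conversion).
[cite: EfremenkoGargOliveiraWigderson2018, §5, p. 15] locator: paper:arxiv-1710.09502 p0015.txt:L28 -/
def HasDepthThreeForm (f : MvPolynomial (Fin n) F) (s D : ℕ) : Prop :=
  ∃ (α : Fin s → F) (ℓ : Fin s → Fin D → Fin n → F),
    f = ∑ i, C (α i) * ∏ j, (1 + linearForm (ℓ i j))

/-- **The simple polynomials of §5:** `Sym_d(ℓ_1(x), …, ℓ_D(x))`, the elementary symmetric polynomial
of degree `d` ("the homogeneous multilinear symmetric polynomial") in `D` linear forms given by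
their coefficient vectors `ℓ : Fin D → Fin n → F` (Mathlib `Multiset.esymm`).
[cite: EfremenkoGargOliveiraWigderson2018, §5, p. 15] locator: paper:arxiv-1710.09502 p0015.txt:L41 -/
def symLinear (d D : ℕ) (ℓ : Fin D → Fin n → F) : MvPolynomial (Fin n) F :=
  ((Finset.univ : Finset (Fin D)).val.map fun j => linearForm (ℓ j)).esymm d

/-- `Sym_d(ℓ_1, …, ℓ_D) = ∑_{|t| = d} ∏_{j ∈ t} ℓ_j`. [cite: EfremenkoGargOliveiraWigderson2018, §5, p. 15] locator: paper:arxiv-1710.09502 p0015.txt:L41 -/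
theorem symLinear_eq_sum (d D : ℕ) (ℓ : Fin D → Fin n → F) :
    symLinear d D ℓ = ∑ t ∈ (Finset.univ : Finset (Fin D)).powersetCard d, ∏ j ∈ t, linearForm (ℓ j) :=
  Finset.esymm_map_val _ _ _

variable (F n) in
/-- **`S_D`**, the set of simple polynomials of the depth-3 instantiation: all
`H_d[∏_{i=1}^{D} (1 + ℓ_i(x))] = Sym_d(ℓ_1(x), …, ℓ_D(x))`, `ℓ_i` linear forms.
[cite: EfremenkoGargOliveiraWigderson2018, §5, p. 15] locator: paper:arxiv-1710.09502 p0015.txt:L38 -/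
def depthThreeSimple (d D : ℕ) : Set (MvPolynomial (Fin n) F) :=
  {p | ∃ ℓ : Fin D → Fin n → F, symLinear d D ℓ = p}

/-- **The displayed identity of §5:** `H_d[∏_{i=1}^{D} (1 + ℓ_i(x))] = Sym_d(ℓ_1(x), …, ℓ_D(x))` for linear
forms `ℓ_i` (expand the product over subsets; `∏_{i ∈ t} ℓ_i` is homogeneous of degree `|t|`).
[cite: EfremenkoGargOliveiraWigderson2018, §5, p. 15] locator: paper:arxiv-1710.09502 p0015.txt:L41 -/
theorem homogeneousComponent_prod_one_add_linearForm (d D : ℕ) (ℓ : Fin D → Fin n → F) :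
    homogeneousComponent d (∏ j, (1 + linearForm (ℓ j))) = symLinear d D ℓ := by
  classical
  rw [Finset.prod_one_add, map_sum, symLinear_eq_sum, Finset.powersetCard_eq_filter,
    Finset.sum_filter]
  refine Finset.sum_congr rfl fun t _ => ?_
  have hhom : (∏ j ∈ t, linearForm (ℓ j)).IsHomogeneous t.card := by
    have h := IsHomogeneous.prod t (fun j => linearForm (ℓ j)) (fun _ => 1)
      (fun j _ => Literature.Barriers.ValiantsHypothesis.isHomogeneous_linearForm (ℓ j))
    simpa using h
  rw [homogeneousComponent_of_mem hhom]
  by_cases h : t.card = d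
  · rw [if_pos h, if_pos h.symm]
  · rw [if_neg h, if_neg (Ne.symm h)]

/-- A homogeneous `f` of degree `d` in the normal form `∑ α_i ∏_j (1 + ℓ_{ij})` is the corresponding
combination of simple polynomials: `f = H_d[f] = ∑ α_i Sym_d(ℓ_{i1}, …, ℓ_{iD})` ("Given this
decomposition, the space of simple functions `S_D` is the set containing each polynomial of the form
`H_d[∏ (1 + ℓ_i)]`", p. 15). [cite: EfremenkoGargOliveiraWigderson2018, §5, p. 15] locator: paper:arxiv-1710.09502 p0015.txt:L38 -/
theorem eq_sum_smul_symLinear_of_hasDepthThreeForm {d s D : ℕ} {f : MvPolynomial (Fin n) F}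
    (hf : f.IsHomogeneous d) {α : Fin s → F} {ℓ : Fin s → Fin D → Fin n → F}
    (hfeq : f = ∑ i, C (α i) * ∏ j, (1 + linearForm (ℓ i j))) :
    f = ∑ i, α i • symLinear d D (ℓ i) := by
  rw [← homogeneousComponent_eq_self hf, hfeq, map_sum]
  refine Finset.sum_congr rfl fun i _ => ?_
  rw [← smul_eq_C_mul, map_smul, homogeneousComponent_prod_one_add_linearForm]

/-- **Soundness of the restated rank method for depth-3 formulas** (§5, last bullet: "To prove a lower
bound of `R` on the size of depth 3 formulas, one has to show that the rank of the space of matrices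
given by `L(Ŝ_D)` is at least `r · R`", where `r` bounds the rank on the simple polynomials). In
usable form: if `L : F[x] → Mat_m(F)` is linear with `rank L(Sym_d(ℓ_1, …, ℓ_D)) ≤ r` for all linear
forms, and the homogeneous degree-`d` polynomial `f` has a depth-3 form of top fan-in `s` and product
fan-in `D`, then `rank L(f) ≤ s · r`; so `rank L(f) > R · r` forces `s > R` (hence size `s + D > R`).
[cite: EfremenkoGargOliveiraWigderson2018, §5, p. 15] locator: paper:arxiv-1710.09502 p0015.txt:L89 -/
theorem rank_le_of_hasDepthThreeForm {m d s D : ℕ}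
    (L : MvPolynomial (Fin n) F →ₗ[F] Matrix (Fin m) (Fin m) F) {r : ℕ}
    (hr : ∀ ℓ : Fin D → Fin n → F, (L (symLinear d D ℓ)).rank ≤ r)
    {f : MvPolynomial (Fin n) F} (hf : f.IsHomogeneous d) (hform : HasDepthThreeForm f s D) :
    (L f).rank ≤ s * r := by
  classical
  obtain ⟨α, ℓ, hfeq⟩ := hform
  rw [eq_sum_smul_symLinear_of_hasDepthThreeForm hf hfeq, map_sum]
  refine (matrix_rank_sum_le _ _).trans ?_
  calc ∑ i, (L (α i • symLinear d D (ℓ i))).rank ≤ ∑ _i : Fin s, r :=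
        Finset.sum_le_sum fun i _ => by
          rw [map_smul]
          by_cases hα : α i = 0
          · simp [hα]
          · rw [Matrix.smul_eq_diagonal_mul]
            exact (Matrix.rank_mul_le_right _ _).trans (hr (ℓ i))
    _ = s * r := by simp

/-- The technique class, contrapositive form: a rank method `L` with `rank L ≤ r` on `S_D` and
`rank L(f) > R · r` PROVES that every depth-3 form of `f` with product fan-in `D` has top fan-in
`s > R`. [cite: EfremenkoGargOliveiraWigderson2018, §5, p. 15] locator: paper:arxiv-1710.09502 p0015.txt:L24 -/
theorem lt_of_hasDepthThreeForm_of_lt_rank {m d s D R : ℕ}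
    (L : MvPolynomial (Fin n) F →ₗ[F] Matrix (Fin m) (Fin m) F) {r : ℕ}
    (hr : ∀ ℓ : Fin D → Fin n → F, (L (symLinear d D ℓ)).rank ≤ r)
    {f : MvPolynomial (Fin n) F} (hf : f.IsHomogeneous d) (hform : HasDepthThreeForm f s D)
    (hR : R * r < (L f).rank) : R < s :=
  lt_of_mul_lt_mul_right (lt_of_lt_of_le hR (rank_le_of_hasDepthThreeForm L hr hf hform))
    (Nat.zero_le r)

variable (F n) in
/-- **The parameter map `ψ` of §5, eq. (5.1):** with parameter variables `y = (y_{ij})`, `i ∈ [D]`,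
`j ∈ [n]`, `ψ(y) = Sym_d(∑_j y_{1j} x_j, …, ∑_j y_{Dj} x_j) ∈ F[y][x]_d` (= `H_{2d}[∏_i (1 + ∑_j y_{ij} x_j)]`
in the joint grading); it parametrises `S_D` (`map_eval_depthThreePsi`: `ψ(ℓ) = Sym_d(ℓ_1, …, ℓ_D)`).
The paper's further claim `𝓛 = {λ ∘ ψ : λ ∈ F[x]_d^*} = SSM(y)` (set-symmetric multilinear polynomials)
is NOT vendored: its displayed symmetrisation map is garbled as printed (module docstring, Errata).
[cite: EfremenkoGargOliveiraWigderson2018, §5 eq. (5.1), p. 15] locator: paper:arxiv-1710.09502 p0015.txt:L49 -/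
def depthThreePsi (d D : ℕ) : MvPolynomial (Fin n) (MvPolynomial (Fin D × Fin n) F) :=
  ((Finset.univ : Finset (Fin D)).val.map fun i =>
    ∑ j : Fin n, C (X (i, j)) * (X j : MvPolynomial (Fin n) (MvPolynomial (Fin D × Fin n) F))).esymm d

/-- **`ψ` parametrises `S_D`:** specialising the parameters `y_{ij} ↦ ℓ_{ij}` in `ψ` gives
`Sym_d(ℓ_1, …, ℓ_D)` ("`ψ : F^t → Ŝ` a polynomial mapping such that the image of `ψ` is `S`", p. 15).
[cite: EfremenkoGargOliveiraWigderson2018, §5, p. 15] locator: paper:arxiv-1710.09502 p0015.txt:L20 -/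
theorem map_eval_depthThreePsi (d D : ℕ) (ℓ : Fin D → Fin n → F) :
    MvPolynomial.map (eval fun p : Fin D × Fin n => ℓ p.1 p.2) (depthThreePsi F n d D) =
      symLinear d D ℓ := by
  classical
  rw [depthThreePsi, symLinear, Finset.esymm_map_val, Finset.esymm_map_val, map_sum]
  refine Finset.sum_congr rfl fun t _ => ?_
  rw [map_prod]
  refine Finset.prod_congr rfl fun i _ => ?_
  rw [map_sum, linearForm]
  refine Finset.sum_congr rfl fun j _ => ?_
  rw [map_mul, map_C, map_X, eval_X]

end DepthThree

/-! ## §3, p. 10: `rk ≤ hrk` and `rk ≤ smrk` (the restricted ranks are attained) -/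

section RankComparisons

variable {F : Type*} [Field F] {σ : Type*} {ι : Type*} [Fintype ι] [DecidableEq ι]

omit [Fintype ι] in
/-- **The column decomposition** `M = ∑_j M[·, j] ⊗ e_j` of a square matrix: every matrix of polynomials
is a sum of `|ι|` rank-one polynomial matrices (so the restricted ranks of §3 are infima of NON-EMPTY
sets under the paper's hypotheses). [cite: EfremenkoGargOliveiraWigderson2018, §3, p. 10] locator: paper:arxiv-1710.09502 p0010.txt:L3 -/
theorem eq_sum_vecMulVec_col_single [Fintype ι] (M : Matrix ι ι (MvPolynomial σ F)) :
    M = ∑ j, Matrix.vecMulVec (fun i => M i j) (Pi.single j 1) := by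
  ext i k
  rw [Matrix.sum_apply, Finset.sum_eq_single k]
  · simp [Matrix.vecMulVec_apply]
  · intro j _ hjk
    simp [Matrix.vecMulVec_apply, Pi.single_eq_of_ne' hjk]
  · intro h
    exact absurd (Finset.mem_univ k) h

omit [Fintype ι] [DecidableEq ι] in
/-- The coordinate vector `e_j` has homogeneous (degree-`0`) polynomial entries. [cite: EfremenkoGargOliveiraWigderson2018, Def 3.1, p. 10] locator: paper:arxiv-1710.09502 p0010.txt:L28 -/
theorem isHomogeneous_single_apply [DecidableEq ι] (j i : ι) :
    ((Pi.single j 1 : ι → MvPolynomial σ F) i).IsHomogeneous 0 := by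
  rcases eq_or_ne i j with rfl | h
  · rw [Pi.single_eq_same]
    exact isHomogeneous_one σ F
  · rw [Pi.single_eq_of_ne h]
    exact isHomogeneous_zero σ F 0

/-- **A homogeneous decomposition always exists** for a matrix with homogeneous degree-`d` entries
(columns ⊗ unit vectors), so `hrk(M) ≤ |ι|` and the infimum in Def 3.1 is attained.
[cite: EfremenkoGargOliveiraWigderson2018, Def 3.1, p. 10] locator: paper:arxiv-1710.09502 p0010.txt:L26 -/
theorem homogRank_le_card_of_isHomogeneous (M : Matrix ι ι (MvPolynomial σ F)) {d : ℕ}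
    (hM : ∀ i j, (M i j).IsHomogeneous d) : homogRank M ≤ Fintype.card ι :=
  homogRank_le_card M (fun j i => M i j) (fun j => Pi.single j 1) (fun _ => d) (fun _ => 0)
    (fun j i => hM i j) (fun j i => isHomogeneous_single_apply j i) (eq_sum_vecMulVec_col_single M)

/-- **`hrk` is attained:** under the hypothesis of Def 3.1 / Lemma 3.3 (homogeneous degree-`d` entries)
there is a homogeneous rank-one decomposition with exactly `hrk(M)` terms.
[cite: EfremenkoGargOliveiraWigderson2018, Def 3.1, p. 10] locator: paper:arxiv-1710.09502 p0010.txt:L26 -/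
theorem exists_decomposition_card_eq_homogRank (M : Matrix ι ι (MvPolynomial σ F)) {d : ℕ}
    (hM : ∀ i j, (M i j).IsHomogeneous d) :
    ∃ (u v : Fin (homogRank M) → ι → MvPolynomial σ F) (du dv : Fin (homogRank M) → ℕ),
      (∀ k i, (u k i).IsHomogeneous (du k)) ∧ (∀ k i, (v k i).IsHomogeneous (dv k)) ∧
        M = ∑ k, Matrix.vecMulVec (u k) (v k) := by
  let e := Fintype.equivFin ι
  have hdec : M = ∑ k : Fin (Fintype.card ι),
      Matrix.vecMulVec (fun i => M i (e.symm k)) (Pi.single (e.symm k) 1) := by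
    conv_lhs => rw [eq_sum_vecMulVec_col_single M]
    exact (Equiv.sum_comp e.symm
      (fun j => Matrix.vecMulVec (fun i => M i j) (Pi.single j (1 : MvPolynomial σ F)))).symm
  exact Nat.sInf_mem (s := {r | ∃ (u v : Fin r → ι → MvPolynomial σ F) (du dv : Fin r → ℕ),
      (∀ k i, (u k i).IsHomogeneous (du k)) ∧ (∀ k i, (v k i).IsHomogeneous (dv k)) ∧
        M = ∑ k, Matrix.vecMulVec (u k) (v k)})
    ⟨Fintype.card ι, fun k i => M i (e.symm k), fun k => Pi.single (e.symm k) 1, fun _ => d,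
      fun _ => 0, fun k i => hM i _, fun k i => isHomogeneous_single_apply _ i, hdec⟩

/-- **`rk_{F(x)}(M) ≤ hrk(M)`** ("such restrictions … impose additional conditions on the vectors
`u_i, v_i`", §3, p. 10): the symbolic rank is at most the homogeneous rank, for matrices with
homogeneous degree-`d` entries; with Lemma 3.3, `rk ≤ hrk ≤ (d+1) · rk` — the window in which
Conjecture 6.1 lives. [cite: EfremenkoGargOliveiraWigderson2018, §3, p. 10] locator: paper:arxiv-1710.09502 p0010.txt:L9 -/
theorem symbolicRank_le_homogRank (M : Matrix ι ι (MvPolynomial σ F)) {d : ℕ}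
    (hM : ∀ i j, (M i j).IsHomogeneous d) : symbolicRank M ≤ homogRank M := by
  obtain ⟨u, v, -, -, -, -, hdec⟩ := exists_decomposition_card_eq_homogRank M hM
  simpa using symbolicRank_le_of_eq_sum_vecMulVec M u v hdec

omit [Fintype ι] in
/-- The coordinate vector `e_j` is set-multilinear over the EMPTY block set (constants).
[cite: EfremenkoGargOliveiraWigderson2018, Def 3.4, p. 11] locator: paper:arxiv-1710.09502 p0011.txt:L25 -/
theorem isSetMultilinear_single_apply {d n : ℕ} (j i : ι) :
    IsSetMultilinear (Prod.fst : Fin d × Fin n → Fin d) ∅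
      ((Pi.single j 1 : ι → MvPolynomial (Fin d × Fin n) F) i) := by
  rcases eq_or_ne i j with rfl | h
  · rw [Pi.single_eq_same, ← C_1]
    exact isSetMultilinear_C _ 1
  · rw [Pi.single_eq_of_ne h]
    exact isSetMultilinear_zero _ ∅

/-- **A set-multilinear decomposition always exists** for a set-multilinear matrix of degree `d`
(columns ⊗ unit vectors, `S = [d]`, `[d] ∖ S = ∅`), so `smrk(M) ≤ |ι|` and the infimum in Def 3.4 is
attained. [cite: EfremenkoGargOliveiraWigderson2018, Def 3.4, p. 11] locator: paper:arxiv-1710.09502 p0011.txt:L19 -/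
theorem smlRank_le_card_of_isSetMultilinear {d n : ℕ} (M : Matrix ι ι (MvPolynomial (Fin d × Fin n) F))
    (hM : ∀ i j, IsSetMultilinear (Prod.fst : Fin d × Fin n → Fin d) Finset.univ (M i j)) :
    smlRank M ≤ Fintype.card ι :=
  smlRank_le_card M (fun j i => M i j) (fun j => Pi.single j 1) (fun _ => Finset.univ)
    (fun j i => hM i j) (fun j i => by
      rw [Finset.compl_univ]
      exact isSetMultilinear_single_apply j i) (eq_sum_vecMulVec_col_single M)

/-- **`smrk` is attained** under the hypothesis of Def 3.4 / Lemma 3.5. [cite: EfremenkoGargOliveiraWigderson2018, Def 3.4, p. 11] locator: paper:arxiv-1710.09502 p0011.txt:L19 -/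
theorem exists_decomposition_card_eq_smlRank {d n : ℕ}
    (M : Matrix ι ι (MvPolynomial (Fin d × Fin n) F))
    (hM : ∀ i j, IsSetMultilinear (Prod.fst : Fin d × Fin n → Fin d) Finset.univ (M i j)) :
    ∃ (u v : Fin (smlRank M) → ι → MvPolynomial (Fin d × Fin n) F)
      (S : Fin (smlRank M) → Finset (Fin d)),
      (∀ k i, IsSetMultilinear (Prod.fst : Fin d × Fin n → Fin d) (S k) (u k i)) ∧
        (∀ k i, IsSetMultilinear (Prod.fst : Fin d × Fin n → Fin d) (S k)ᶜ (v k i)) ∧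
          M = ∑ k, Matrix.vecMulVec (u k) (v k) := by
  let e := Fintype.equivFin ι
  have hdec : M = ∑ k : Fin (Fintype.card ι),
      Matrix.vecMulVec (fun i => M i (e.symm k)) (Pi.single (e.symm k) 1) := by
    conv_lhs => rw [eq_sum_vecMulVec_col_single M]
    exact (Equiv.sum_comp e.symm (fun j => Matrix.vecMulVec (fun i => M i j)
      (Pi.single j (1 : MvPolynomial (Fin d × Fin n) F)))).symm
  exact Nat.sInf_mem (s := {r | ∃ (u v : Fin r → ι → MvPolynomial (Fin d × Fin n) F)
      (S : Fin r → Finset (Fin d)),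
      (∀ k i, IsSetMultilinear (Prod.fst : Fin d × Fin n → Fin d) (S k) (u k i)) ∧
        (∀ k i, IsSetMultilinear (Prod.fst : Fin d × Fin n → Fin d) (S k)ᶜ (v k i)) ∧
          M = ∑ k, Matrix.vecMulVec (u k) (v k)})
    ⟨Fintype.card ι, fun k i => M i (e.symm k), fun k => Pi.single (e.symm k) 1,
      fun _ => Finset.univ, fun k i => hM i _, fun k i => by
        rw [Finset.compl_univ]
        exact isSetMultilinear_single_apply _ i, hdec⟩

/-- **`rk_{F(x)}(M) ≤ smrk(M)`** for set-multilinear matrices of degree `d` (§3, p. 10); with Lemma 3.5,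
`rk ≤ smrk ≤ 2^d · rk`. [cite: EfremenkoGargOliveiraWigderson2018, §3, p. 10] locator: paper:arxiv-1710.09502 p0010.txt:L9 -/
theorem symbolicRank_le_smlRank {d n : ℕ} (M : Matrix ι ι (MvPolynomial (Fin d × Fin n) F))
    (hM : ∀ i j, IsSetMultilinear (Prod.fst : Fin d × Fin n → Fin d) Finset.univ (M i j)) :
    symbolicRank M ≤ smlRank M := by
  obtain ⟨u, v, -, -, -, hdec⟩ := exists_decomposition_card_eq_smlRank M hM
  simpa using symbolicRank_le_of_eq_sum_vecMulVec M u v hdec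

end RankComparisons

end Literature.Computability.AlgebraicComplexity
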